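import Literature.Topology.FourManifolds.MMSWPictureSurgeryProofs
import Literature.Topology.FourManifolds.MMSWRasmussenGeneralPosition

/-!
# Helper `helper_friendsCarrier_Vk_partA_partI` (V_k part A, part I: the tube framing is the Seifert
framing), piece 1: the standard picture as a homeomorphism and the picture sets
(line `mk_friends`, crux `DcrGap`; item stmt-SmoothPoincare4-16128, route route-SmoothPoincare4-DottedCircleRasmussen)

Part I of V_k part A transfers the `0`-framing of the picture tube `ν'` of the picture knot `J = P ∘ K₁`
(`P = stereoNorthInv ∘ draw k`, the standard picture of `M_k ∖ {cores}` in `𝕊³`, Kirby's Lemma I.2.1)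
back to `M_k ∖ K₁` by a Mayer–Vietoris argument in `𝕊³ ∖ J` for the cover by the picture
`V = P(M_k ∖ {cores})` and the complement `O_ε = 𝕊³ ∖ P(M_k ∩ {|w|² ≥ ε})` of a compact part of it.
This file collects the point-set facts about these sets:

* `FriendsCarrierVk.pic_lift_P`, `pic_P_lift`, `pic_injOn` — `P` is inverted by the chart lift
  `y ↦ chartLift k (stereoNorthCoords y)` (the tree's `chartLift_draw`, `draw_chartLift`);
* `pic_mem_image_iff`, `pic_isOpen_image` — `V = {y ≠ N, stereoNorthCoords y ∈ pictureRegion k}` is open,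
  `pic_continuousOn_lift` — the chart lift is continuous on it, `pic_continuousOn_P` — `P` is continuous
  off the cores;
* `pic_isCompact_image_ge` — `P(M_k ∩ {|w|² ≥ ε})` is compact (so `O_ε` is open);
* `pic_inter_compl_eq` — `V ∩ O_ε = P(M_k ∩ {0 < |w|² < ε})`;
* `pic_far_or_near_of_mem_compl` — a point of `O_ε` (`ε ≤ 1/20`) off the north pole and the axis reads
  a planar point `z` which is far (`|z| > 20(k+1)`) or near a unique hole (`|z − c_j| < 27/20`).

No definitions, no named facts, no `sorry`.

## References

* R. Kirby, *The Topology of 4-Manifolds*, LNM 1374 (1989), Ch. I §2, Lemma 2.1. [Kirby1989]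
* C. Manolescu, M. Marengon, S. Sarkar, M. Willis, Duke Math. J. 172 (2023), Def. 8.26. [ManolescuMarengonSarkarWillis2023]
-/

set_option linter.dupNamespace false
set_option linter.style.longLine false

noncomputable section

open scoped Manifold ContDiff Topology ComplexConjugate
open Function Set Metric TopologicalSpace Literature.Topology.FourManifolds Literature.Topology.FourManifolds.MMSW Literature.AlgebraicTopology.Homotopy.HopfFibration

namespace Summit.SmoothPoincare4.SmoothPoincare4.Theorems.DcrGap.MkFriends

namespace FriendsCarrierVk

variable {k : ℕ}

/-! ## The picture and its inverse -/

/-- The chart coordinates of the picture point are the standard picture. [folklore] -/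
theorem pic_coords_P (k : ℕ) (x : EuclideanSpace ℝ (Fin 4)) :
    stereoNorthCoords ((stereoNorthInv (draw k x) : sphere (0 : EuclideanSpace ℝ (Fin 4)) 1) : EuclideanSpace ℝ (Fin 4)) = draw k x := by
  rw [coe_stereoNorthInv, stereoNorthCoords_stereoNorthInvCoe]

/-- **The chart lift inverts the picture** on `M_k ∖ {cores}`. [cite: Kirby1989, Ch. I §2] -/
theorem pic_lift_P {x : EuclideanSpace ℝ (Fin 4)} (hx : x ∈ modelBoundary k) (hw : wC x ≠ 0) :
    chartLift k (stereoNorthCoords ((stereoNorthInv (draw k x) : sphere (0 : EuclideanSpace ℝ (Fin 4)) 1) : EuclideanSpace ℝ (Fin 4))) = x := by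
  rw [pic_coords_P, chartLift_draw hx hw]

/-- **The picture inverts the chart lift** on the picture region. [cite: Kirby1989, Ch. I §2] -/
theorem pic_P_lift {y : sphere (0 : EuclideanSpace ℝ (Fin 4)) 1} (hy : y ≠ northPole)
    (hreg : stereoNorthCoords (y : EuclideanSpace ℝ (Fin 4)) ∈ pictureRegion k) :
    stereoNorthInv (draw k (chartLift k (stereoNorthCoords (y : EuclideanSpace ℝ (Fin 4))))) = y := by
  rw [draw_chartLift hreg, stereoNorthInv_stereoNorthCoords hy]

/-- The picture is injective on `M_k ∖ {cores}`. [folklore] -/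
theorem pic_injOn : InjOn (fun x : EuclideanSpace ℝ (Fin 4) => stereoNorthInv (draw k x))
    {x | x ∈ modelBoundary k ∧ wC x ≠ 0} := by
  intro x hx x' hx' h
  have h1 := pic_lift_P hx.1 hx.2
  have h2 := pic_lift_P hx'.1 hx'.2
  simp only at h
  rw [h] at h1
  exact h1.symm.trans h2

/-- **The picture of `M_k ∖ {cores}`** is the set of points off the north pole whose chart coordinates lie
in the picture region. [cite: Kirby1989, Ch. I §2] -/
theorem pic_mem_image_iff (y : sphere (0 : EuclideanSpace ℝ (Fin 4)) 1) :
    y ∈ (fun x : EuclideanSpace ℝ (Fin 4) => stereoNorthInv (draw k x)) '' {x | x ∈ modelBoundary k ∧ wC x ≠ 0} ↔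
      y ≠ northPole ∧ stereoNorthCoords (y : EuclideanSpace ℝ (Fin 4)) ∈ pictureRegion k := by
  constructor
  · rintro ⟨x, ⟨hx, hw⟩, rfl⟩
    exact ⟨stereoNorthInv_ne_northPole _, by rw [pic_coords_P]; exact draw_mem_pictureRegion hx hw⟩
  · rintro ⟨hy, hreg⟩
    exact ⟨chartLift k (stereoNorthCoords (y : EuclideanSpace ℝ (Fin 4))),
      ⟨chartLift_mem_modelBoundary hreg, wC_chartLift_ne_zero hreg⟩, pic_P_lift hy hreg⟩

/-- The chart coordinates are continuous off the north pole. [folklore] -/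
theorem pic_continuousOn_coords : ContinuousOn
    (fun y : sphere (0 : EuclideanSpace ℝ (Fin 4)) 1 => stereoNorthCoords (y : EuclideanSpace ℝ (Fin 4))) {y | y ≠ northPole} :=
  fun _ hy => ((contDiffAt_stereoNorthCoords (apply_three_ne_one_of_ne_northPole hy)).continuousAt.comp
    continuous_subtype_val.continuousAt).continuousWithinAt

/-- **The picture of `M_k ∖ {cores}` is open in `𝕊³`.** [folklore] -/
theorem pic_isOpen_image : IsOpen ((fun x : EuclideanSpace ℝ (Fin 4) => stereoNorthInv (draw k x)) ''
    {x | x ∈ modelBoundary k ∧ wC x ≠ 0}) := by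
  have h : (fun x : EuclideanSpace ℝ (Fin 4) => stereoNorthInv (draw k x)) '' {x | x ∈ modelBoundary k ∧ wC x ≠ 0} =
      {y : sphere (0 : EuclideanSpace ℝ (Fin 4)) 1 | y ≠ northPole} ∩
        (fun y : sphere (0 : EuclideanSpace ℝ (Fin 4)) 1 => stereoNorthCoords (y : EuclideanSpace ℝ (Fin 4))) ⁻¹' pictureRegion k := by
    ext y; rw [pic_mem_image_iff]; rfl
  rw [h]
  exact pic_continuousOn_coords.isOpen_inter_preimage (isOpen_ne_fun continuous_id continuous_const) isOpen_pictureRegion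

/-- **The chart lift is continuous on the picture.** [folklore] -/
theorem pic_continuousOn_lift : ContinuousOn
    (fun y : sphere (0 : EuclideanSpace ℝ (Fin 4)) 1 => chartLift k (stereoNorthCoords (y : EuclideanSpace ℝ (Fin 4))))
    ((fun x : EuclideanSpace ℝ (Fin 4) => stereoNorthInv (draw k x)) '' {x | x ∈ modelBoundary k ∧ wC x ≠ 0}) := by
  intro y hy
  obtain ⟨hN, hreg⟩ := (pic_mem_image_iff y).1 hy
  have h1 : ContinuousAt (fun y : sphere (0 : EuclideanSpace ℝ (Fin 4)) 1 => stereoNorthCoords (y : EuclideanSpace ℝ (Fin 4))) y :=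
    (pic_continuousOn_coords y hN).continuousAt ((isOpen_ne_fun continuous_id continuous_const).mem_nhds hN)
  exact (ContinuousAt.comp (x := y) (contDiffAt_chartLift hreg).continuousAt h1).continuousWithinAt

/-- **The picture is continuous off the cores.** [folklore] -/
theorem pic_continuousOn_P : ContinuousOn (fun x : EuclideanSpace ℝ (Fin 4) => stereoNorthInv (draw k x))
    {x | wC x ≠ 0} := fun _ hx =>
  (continuous_stereoNorthInv.continuousAt.comp (contDiffAt_draw (n := ∞) hx).continuousAt).continuousWithinAt

/-- **The picture of `M_k ∩ {|w|² ≥ ε}` is compact** (`ε > 0`). [folklore] -/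
theorem pic_isCompact_image_ge {ε : ℝ} (hε : 0 < ε) :
    IsCompact ((fun x : EuclideanSpace ℝ (Fin 4) => stereoNorthInv (draw k x)) ''
      {x | x ∈ modelBoundary k ∧ ε ≤ ‖wC x‖ ^ 2}) := by
  have hc : IsCompact {x : EuclideanSpace ℝ (Fin 4) | x ∈ modelBoundary k ∧ ε ≤ ‖wC x‖ ^ 2} :=
    isCompact_modelBoundary.inter_right (isClosed_le continuous_const ((continuous_wC.norm).pow 2))
  refine hc.image_of_continuousOn (pic_continuousOn_P.mono ?_)
  rintro x ⟨-, hx⟩ h0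
  rw [h0, norm_zero] at hx
  simp at hx
  linarith

/-- Membership of a picture point in the complement `O_ε = 𝕊³ ∖ P(M_k ∩ {|w|² ≥ ε})`: for `x ∈ M_k` off
the cores, `P x ∈ O_ε ↔ |w(x)|² < ε`. [folklore] -/
theorem pic_mem_compl_iff {ε : ℝ} (hε : 0 < ε) {x : EuclideanSpace ℝ (Fin 4)} (hx : x ∈ modelBoundary k) (hw : wC x ≠ 0) :
    stereoNorthInv (draw k x) ∈ ((fun x : EuclideanSpace ℝ (Fin 4) => stereoNorthInv (draw k x)) ''
      {x | x ∈ modelBoundary k ∧ ε ≤ ‖wC x‖ ^ 2})ᶜ ↔ ‖wC x‖ ^ 2 < ε := by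
  rw [mem_compl_iff]
  constructor
  · intro h
    by_contra hlt
    exact h ⟨x, ⟨hx, not_lt.1 hlt⟩, rfl⟩
  · rintro hlt ⟨x', ⟨hx', hε'⟩, he⟩
    have hw' : wC x' ≠ 0 := by
      intro h0; rw [h0, norm_zero] at hε'
      have : (0 : ℝ) ^ 2 = 0 := by norm_num
      linarith
    have := pic_injOn ⟨hx', hw'⟩ ⟨hx, hw⟩ he
    subst this
    linarith

/-- **`V ∩ O_ε = P(M_k ∩ {0 < |w|² < ε})`.** [folklore] -/
theorem pic_inter_compl_eq {ε : ℝ} (hε : 0 < ε) :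
    (fun x : EuclideanSpace ℝ (Fin 4) => stereoNorthInv (draw k x)) '' {x | x ∈ modelBoundary k ∧ wC x ≠ 0} ∩
      ((fun x : EuclideanSpace ℝ (Fin 4) => stereoNorthInv (draw k x)) '' {x | x ∈ modelBoundary k ∧ ε ≤ ‖wC x‖ ^ 2})ᶜ =
      (fun x : EuclideanSpace ℝ (Fin 4) => stereoNorthInv (draw k x)) ''
        {x | x ∈ modelBoundary k ∧ wC x ≠ 0 ∧ ‖wC x‖ ^ 2 < ε} := by
  ext y
  constructor
  · rintro ⟨⟨x, ⟨hx, hw⟩, rfl⟩, hy⟩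
    exact ⟨x, ⟨hx, hw, (pic_mem_compl_iff hε hx hw).1 hy⟩, rfl⟩
  · rintro ⟨x, ⟨hx, hw, hlt⟩, rfl⟩
    exact ⟨⟨x, ⟨hx, hw⟩, rfl⟩, (pic_mem_compl_iff hε hx hw).2 hlt⟩

/-! ## Reading the planar point of a point of `O_ε` -/

/-- A point of `𝕊³` off the north pole and off the axis is the picture chart point of its planar point
`z = chartZ` seen from the direction of its planar position. [folklore] -/
theorem pic_eq_stereoNorthInv_cpt {y : sphere (0 : EuclideanSpace ℝ (Fin 4)) 1} (hy : y ≠ northPole) :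
    y = stereoNorthInv (cpt k (chartZ k (stereoNorthCoords (y : EuclideanSpace ℝ (Fin 4))))
      (dirC (stereoNorthCoords (y : EuclideanSpace ℝ (Fin 4))))) := by
  rw [cpt_chartZ_dirC, stereoNorthInv_stereoNorthCoords hy]

/-- **A point of `O_ε` off the north pole and the axis reads a planar point inside a hole or of potential
`> 1 − ε`**: otherwise it is the picture of a point of `M_k` with `|w|² ≥ ε`. [folklore] -/
theorem pic_mem_compl_imp {ε : ℝ} (hε : 0 < ε) {y : sphere (0 : EuclideanSpace ℝ (Fin 4)) 1}
    (hy : y ∈ ((fun x : EuclideanSpace ℝ (Fin 4) => stereoNorthInv (draw k x)) ''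
      {x | x ∈ modelBoundary k ∧ ε ≤ ‖wC x‖ ^ 2})ᶜ)
    (hN : y ≠ northPole) (hC : chartC (stereoNorthCoords (y : EuclideanSpace ℝ (Fin 4))) ≠ 0) :
    (∃ j : Fin k, Complex.normSq (chartZ k (stereoNorthCoords (y : EuclideanSpace ℝ (Fin 4))) - holeCentre k j) ≤ 1) ∨
      1 - ε < planarPot k (chartZ k (stereoNorthCoords (y : EuclideanSpace ℝ (Fin 4)))) := by
  by_contra h
  push Not at h
  obtain ⟨hguard, hpot⟩ := h
  set c := stereoNorthCoords (y : EuclideanSpace ℝ (Fin 4)) with hc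
  have hreg : c ∈ pictureRegion k := ⟨hC, hguard, by linarith⟩
  have hx : chartLift k c ∈ modelBoundary k := chartLift_mem_modelBoundary hreg
  have hw : ε ≤ ‖wC (chartLift k c)‖ ^ 2 := by
    rw [← Complex.normSq_eq_norm_sq, normSq_wC_chartLift hreg]; linarith
  exact hy ⟨chartLift k c, ⟨hx, hw⟩, pic_P_lift hN hreg⟩

/-- **Far or near**: a point of `O_ε` (`0 < ε ≤ 1/20`) off the north pole and the axis reads a planar point
with `|z| > 20(k+1)` or `|z − c_j| < 27/20` for some hole `j`. [folklore] -/
theorem pic_far_or_near_of_mem_compl {ε : ℝ} (hε0 : 0 < ε) (hε : ε ≤ 1 / 20) {y : sphere (0 : EuclideanSpace ℝ (Fin 4)) 1}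
    (hy : y ∈ ((fun x : EuclideanSpace ℝ (Fin 4) => stereoNorthInv (draw k x)) ''
      {x | x ∈ modelBoundary k ∧ ε ≤ ‖wC x‖ ^ 2})ᶜ)
    (hN : y ≠ northPole) (hC : chartC (stereoNorthCoords (y : EuclideanSpace ℝ (Fin 4))) ≠ 0) :
    20 * ((k : ℝ) + 1) < ‖chartZ k (stereoNorthCoords (y : EuclideanSpace ℝ (Fin 4)))‖ ∨
      ∃ j : Fin k, ‖chartZ k (stereoNorthCoords (y : EuclideanSpace ℝ (Fin 4))) - holeCentre k j‖ < 27 / 20 := by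
  rcases pic_mem_compl_imp hε0 hy hN hC with ⟨j, hj⟩ | hpot
  · right
    refine ⟨j, ?_⟩
    rw [Complex.normSq_eq_norm_sq] at hj
    nlinarith [norm_nonneg (chartZ k (stereoNorthCoords (y : EuclideanSpace ℝ (Fin 4))) - holeCentre k j)]
  · rcases far_or_near_of_le_planarPot (k := k) (Z := chartZ k (stereoNorthCoords (y : EuclideanSpace ℝ (Fin 4)))) (by linarith) with hfar | hnear
    · left; rw [bigRadius] at hfar; linarith
    · exact Or.inr hnear

/-- Far and near exclude each other, and near holes are unique: if `|z − c_j| < 27/20` then `|z| < 20(k+1) − 1`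
and `|z − c_i| > 2` for `i ≠ j`. [folklore] -/
theorem pic_near_bounds {z : ℂ} {j : Fin k} (hj : ‖z - holeCentre k j‖ < 27 / 20) :
    ‖z‖ < 20 * ((k : ℝ) + 1) - 1 ∧ ∀ i : Fin k, i ≠ j → 2 < ‖z - holeCentre k i‖ := by
  have hk : ((j : ℕ) : ℝ) + 1 ≤ k := by exact_mod_cast j.2
  have hcj : ‖holeCentre k j‖ = 4 * (((j : ℕ) : ℝ) + 1) := by
    rw [holeCentre, Complex.norm_real, Real.norm_of_nonneg (by positivity)]
  constructor
  · have h1 : ‖z‖ ≤ ‖z - holeCentre k j‖ + ‖holeCentre k j‖ := norm_le_norm_sub_add z _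
    rw [hcj] at h1
    nlinarith
  · intro i hij
    have h4 := four_le_norm_holeCentre_sub (k := k) hij
    have h2 : ‖holeCentre k i - holeCentre k j‖ ≤ ‖z - holeCentre k i‖ + ‖z - holeCentre k j‖ := by
      calc ‖holeCentre k i - holeCentre k j‖ = ‖(z - holeCentre k j) - (z - holeCentre k i)‖ := by ring_nf
        _ ≤ ‖z - holeCentre k j‖ + ‖z - holeCentre k i‖ := norm_sub_le _ _
        _ = _ := add_comm _ _
    linarith

end FriendsCarrierVk

open FriendsCarrierVk in
/-- **Piece 1 of part I of V_k part A: the picture sets.**  For `0 < ε ≤ 1/20`: the picture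
`V = P(M_k ∖ {cores})` (`P = stereoNorthInv ∘ draw k`) is open in `𝕊³`, the picture of `M_k ∩ {|w|² ≥ ε}`
is compact, `V ∖ P(M_k ∩ {|w|² ≥ ε}) = P(M_k ∩ {0 < |w|² < ε})`, and every point of
`𝕊³ ∖ P(M_k ∩ {|w|² ≥ ε})` off the north pole and the axis reads a planar point which is far or near a hole.
[cite: Kirby1989, Ch. I §2, Lemma 2.1] -/
theorem helper_friendsCarrier_Vk_partA_partI_picture : ∀ (k : ℕ) (ε : ℝ), 0 < ε → ε ≤ 1 / 20 → IsOpen ((fun x : EuclideanSpace ℝ (Fin 4) => stereoNorthInv (draw k x)) '' {x | x ∈ modelBoundary k ∧ wC x ≠ 0}) ∧ IsCompact ((fun x : EuclideanSpace ℝ (Fin 4) => stereoNorthInv (draw k x)) '' {x | x ∈ modelBoundary k ∧ ε ≤ ‖wC x‖ ^ 2}) ∧ ((fun x : EuclideanSpace ℝ (Fin 4) => stereoNorthInv (draw k x)) '' {x | x ∈ modelBoundary k ∧ wC x ≠ 0} ∩ ((fun x : EuclideanSpace ℝ (Fin 4) => stereoNorthInv (draw k x)) '' {x | x ∈ modelBoundary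 k ∧ ε ≤ ‖wC x‖ ^ 2})ᶜ = (fun x : EuclideanSpace ℝ (Fin 4) => stereoNorthInv (draw k x)) '' {x | x ∈ modelBoundary k ∧ wC x ≠ 0 ∧ ‖wC x‖ ^ 2 < ε}) ∧ ∀ y : sphere (0 : EuclideanSpace ℝ (Fin 4)) 1, y ∈ ((fun x : EuclideanSpace ℝ (Fin 4) => stereoNorthInv (draw k x)) '' {x | x ∈ modelBoundary k ∧ ε ≤ ‖wC x‖ ^ 2})ᶜ → y ≠ northPole → chartC (stereoNorthCoords (y : EuclideanSpace ℝ (Fin 4))) ≠ 0 → (20 * ((k : ℝ) + 1) < ‖chartZ k (stereoNorthCoords (y : EuclideanSpace ℝ (Fin 4)))‖ ∨ ∃ j : Fin k, ‖chartZ k (stereoNorthCoords (y : EuclideanSpace ℝ (Fin 4))) - holeCentre k j‖ < 27 / 20) :=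
  fun _ _ hε hε' => ⟨pic_isOpen_image, pic_isCompact_image_ge hε, pic_inter_compl_eq hε,
    fun _ hy hN hC => pic_far_or_near_of_mem_compl hε hε' hy hN hC⟩

end Summit.SmoothPoincare4.SmoothPoincare4.Theorems.DcrGap.MkFriends
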